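import Summits.ValiantsHypothesis.ValiantsHypothesis.Theorems.MonotoneRestorationOrbitRestorationQPWildResidueSharp
import Summits.ValiantsHypothesis.ValiantsHypothesis.Theorems.MonotoneRestorationOrbitRestorationQPTermBlocks
import HarnessLib

/-!
# The wild residue of `A_∞` may assume the polynomial has NO BLOCK-GROUPABLE representation (fourth exclusion)

Route MonotoneRestoration, crux `OrbitRestorationQP` (stmt-ValiantsHypothesis-18293), line `depth-three-rung`, rung
`A_∞ = stub_sigmaPiSigmaValue`; namespace
`Summit.ValiantsHypothesis.ValiantsHypothesis.Theorems.OrbitRestorationQPDepthThreeRung.WildResidueSharp`.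

`…WildResidueSharp.lean` reduces the registered stub BY NAME to the residue of matrix-symmetric `p ∈ PDClass (fun _ => 1) n c`
without groupable representation that moreover escape the three strata `ℂ[r,c]`, row wreath, column wreath
(`wildResidue_of_sharp₃`, `sigmaPiSigmaValue_of_sharpResidue₃`).  The term-block criterion
(`TermBlocks.qpOrbitRestorable_of_termBlocks`, `…TermBlocks.lean`) restores, with the uniform constant `c + 5`, every `p`
that has a BLOCK-GROUPABLE depth-three representation with budget `c`: `p = Σ_t C(a t) · Π_{key b = t} Π M_b` over finite
`Sym(Fin n)`-sets of blocks `B` and terms `T` (equivariant key, invariant coefficient), the `M_b` multisets of affine forms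
fixed by the pointwise stabiliser of `≤ c` indices and exactly permuted by one, block PRODUCTS honestly permuted
(`σ · Π M_b = Π M_{σ • b}` — the factor multisets may be sign-twisted), terms with a non-empty block fixed by the pointwise
stabiliser of `≤ c` indices.  This kind (P) contains kind (T) (singleton untwisted blocks) and the many-term sign-twisted
systems such as `e₂` of the column Vandermondes (`…TermBlocksPairedVandermondes.lean`), which none of (T)/(S)/(B)/(K)
covers.  So the residue-prover may assume, in addition, that `p` has NO such representation:

* `wildResidue_of_sharp₄` — sharper residue with FOUR exclusions ⇒ `WildResidue K` (any budget `K`);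
* `sigmaPiSigmaValue_of_sharpResidue₄` — hence ⇒ `A_∞` (conclusion = the registered stub verbatim).

The block-groupable kind is spelled out inline (no new definition).  Calibration: bookkeeping over landed theorems;
conjecture-grade residue of a conjecture-grade rung; nothing here bears on VP ≠ VNP. [folklore]
[cite: DawarWilsenach2025, §3.3]
-/

noncomputable section

open scoped Classical Pointwise

-- `Summit.ValiantsHypothesis.ValiantsHypothesis.…` is the tree's single-conjunct layout (Sub = Summit).
set_option linter.dupNamespace false

namespace Summit.ValiantsHypothesis.ValiantsHypothesis.Theorems.OrbitRestorationQPDepthThreeRung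

namespace WildResidueSharp

open MvPolynomial Equiv Finset Literature.Computability.AlgebraicComplexity

/-- **SHARPER RESIDUE, FOUR EXCLUSIONS ⇒ WILD RESIDUE (any budget `K`).**  Besides `p ∉ ℂ[r,c]`, `p` not row-wreath and not
column-wreath invariant, the residue-prover may assume that `p` has NO block-groupable depth-three representation with budget
`c` (kind (P), spelled out inline: finite `Sym(Fin n)`-sets of blocks and terms, equivariant key, invariant coefficient, affine
forms and block multisets fixed / exactly permuted by pointwise stabilisers of `≤ c` indices, block products honestly permuted,
terms with a non-empty block fixed by a pointwise stabiliser of `≤ c` indices) — those are `QPOrbitRestorable (c + 5)` by the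
term-block criterion. [folklore; cite: DawarWilsenach2025, §3.3] -/
theorem wildResidue_of_sharp₄ (K : ℕ → ℕ)
    (hW : ∀ c : ℕ, ∃ c' : ℕ, ∀ (n : ℕ) (p : MvPolynomial (Fin n × Fin n) ℂ),
      (∀ σ τ : Perm (Fin n), rename (fun q : Fin n × Fin n => (σ q.1, τ q.2)) p = p) →
      PDClass (fun _ => 1) n c p → ¬ GroupableUpTo (K c) n c p →
      (∃ a a' b b' : Fin n, pderiv (a, b) p - pderiv (a', b) p - pderiv (a, b') p + pderiv (a', b') p ≠ 0) →
      (∃ (i : Fin n) (τ : Perm (Fin n)),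
        rename (fun q : Fin n × Fin n => if q.1 = i then (q.1, τ q.2) else q) p ≠ p) →
      (∃ (j : Fin n) (τ : Perm (Fin n)),
        rename (fun q : Fin n × Fin n => if q.2 = j then (τ q.1, q.2) else q) p ≠ p) →
      ¬ (∃ (B T : Type) (_ : Fintype B) (_ : Fintype T) (_ : MulAction (Perm (Fin n)) B)
          (_ : MulAction (Perm (Fin n)) T) (key : B → T) (M : B → Multiset (MvPolynomial (Fin n × Fin n) ℂ))
          (a : T → ℂ),
          (∀ (σ : Perm (Fin n)) (b : B), key (σ • b) = σ • key b) ∧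
          (∀ (σ : Perm (Fin n)) (t : T), a (σ • t) = a t) ∧
          (∀ b, ∀ q ∈ M b, q.totalDegree ≤ 1) ∧
          (∀ b, ∀ q ∈ M b, ∃ X : Finset (Fin n), X.card ≤ c ∧
            ∀ σ : Perm (Fin n), (∀ x ∈ X, σ x = x) → ren σ q = q) ∧
          (∀ b, ∃ K : Finset (Fin n), K.card ≤ c ∧
            ∀ σ : Perm (Fin n), (∀ x ∈ K, σ x = x) → (M b).map (ren σ) = M b) ∧
          (∀ (σ : Perm (Fin n)) (b : B), ren σ (M b).prod = (M (σ • b)).prod) ∧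
          (∀ t : T, (∃ b, key b = t ∧ M b ≠ 0) → ∃ K : Finset (Fin n), K.card ≤ c ∧
            ∀ σ : Perm (Fin n), (∀ x ∈ K, σ x = x) → σ • t = t) ∧
          p = ∑ t, C (a t) * ∏ b ∈ univ.filter (fun b => key b = t), (M b).prod) →
      QPOrbitRestorable c' n p) :
    WildResidue K := by
  refine wildResidue_of_sharp₃ K fun c => ?_
  obtain ⟨c', hc'⟩ := hW c
  refine ⟨max c' (c + 5), fun n p hsym hPD hng hD hrow hcol => ?_⟩
  by_cases hP : ∃ (B T : Type) (_ : Fintype B) (_ : Fintype T) (_ : MulAction (Perm (Fin n)) B)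
      (_ : MulAction (Perm (Fin n)) T) (key : B → T) (M : B → Multiset (MvPolynomial (Fin n × Fin n) ℂ))
      (a : T → ℂ),
      (∀ (σ : Perm (Fin n)) (b : B), key (σ • b) = σ • key b) ∧
      (∀ (σ : Perm (Fin n)) (t : T), a (σ • t) = a t) ∧
      (∀ b, ∀ q ∈ M b, q.totalDegree ≤ 1) ∧
      (∀ b, ∀ q ∈ M b, ∃ X : Finset (Fin n), X.card ≤ c ∧
        ∀ σ : Perm (Fin n), (∀ x ∈ X, σ x = x) → ren σ q = q) ∧
      (∀ b, ∃ K : Finset (Fin n), K.card ≤ c ∧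
        ∀ σ : Perm (Fin n), (∀ x ∈ K, σ x = x) → (M b).map (ren σ) = M b) ∧
      (∀ (σ : Perm (Fin n)) (b : B), ren σ (M b).prod = (M (σ • b)).prod) ∧
      (∀ t : T, (∃ b, key b = t ∧ M b ≠ 0) → ∃ K : Finset (Fin n), K.card ≤ c ∧
        ∀ σ : Perm (Fin n), (∀ x ∈ K, σ x = x) → σ • t = t) ∧
      p = ∑ t, C (a t) * ∏ b ∈ univ.filter (fun b => key b = t), (M b).prod
  · obtain ⟨B, T, iB, iT, aB, aT, key, M, a, hkey, ha, hAff, hSupp, hPerm, hEqv, hT, hp⟩ := hP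
    rw [hp]
    exact Restorable.qpOrbitRestorable_mono (le_max_right _ _)
      (TermBlocks.qpOrbitRestorable_of_termBlocks key hkey M a ha hAff hSupp hPerm hEqv hT)
  · exact Restorable.qpOrbitRestorable_mono (le_max_left _ _) (hc' n p hsym hPD hng hD hrow hcol hP)

/-- **SHARPER RESIDUE, FOUR EXCLUSIONS ⇒ `A_∞`** (budget `0`; conclusion = the registered stub `stub_sigmaPiSigmaValue`
verbatim): it suffices to restore the matrix-symmetric `p ∈ PDClass (fun _ => 1) n c` without groupable representation that are
outside `ℂ[r,c]`, not row-wreath invariant, not column-wreath invariant, AND without block-groupable representation of budget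
`c`. [folklore; cite: DawarWilsenach2025, §3.3] -/
theorem sigmaPiSigmaValue_of_sharpResidue₄
    (hW : ∀ c : ℕ, ∃ c' : ℕ, ∀ (n : ℕ) (p : MvPolynomial (Fin n × Fin n) ℂ),
      (∀ σ τ : Perm (Fin n), rename (fun q : Fin n × Fin n => (σ q.1, τ q.2)) p = p) →
      PDClass (fun _ => 1) n c p → ¬ GroupableUpTo 0 n c p →
      (∃ a a' b b' : Fin n, pderiv (a, b) p - pderiv (a', b) p - pderiv (a, b') p + pderiv (a', b') p ≠ 0) →
      (∃ (i : Fin n) (τ : Perm (Fin n)),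
        rename (fun q : Fin n × Fin n => if q.1 = i then (q.1, τ q.2) else q) p ≠ p) →
      (∃ (j : Fin n) (τ : Perm (Fin n)),
        rename (fun q : Fin n × Fin n => if q.2 = j then (τ q.1, q.2) else q) p ≠ p) →
      ¬ (∃ (B T : Type) (_ : Fintype B) (_ : Fintype T) (_ : MulAction (Perm (Fin n)) B)
          (_ : MulAction (Perm (Fin n)) T) (key : B → T) (M : B → Multiset (MvPolynomial (Fin n × Fin n) ℂ))
          (a : T → ℂ),
          (∀ (σ : Perm (Fin n)) (b : B), key (σ • b) = σ • key b) ∧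
          (∀ (σ : Perm (Fin n)) (t : T), a (σ • t) = a t) ∧
          (∀ b, ∀ q ∈ M b, q.totalDegree ≤ 1) ∧
          (∀ b, ∀ q ∈ M b, ∃ X : Finset (Fin n), X.card ≤ c ∧
            ∀ σ : Perm (Fin n), (∀ x ∈ X, σ x = x) → ren σ q = q) ∧
          (∀ b, ∃ K : Finset (Fin n), K.card ≤ c ∧
            ∀ σ : Perm (Fin n), (∀ x ∈ K, σ x = x) → (M b).map (ren σ) = M b) ∧
          (∀ (σ : Perm (Fin n)) (b : B), ren σ (M b).prod = (M (σ • b)).prod) ∧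
          (∀ t : T, (∃ b, key b = t ∧ M b ≠ 0) → ∃ K : Finset (Fin n), K.card ≤ c ∧
            ∀ σ : Perm (Fin n), (∀ x ∈ K, σ x = x) → σ • t = t) ∧
          p = ∑ t, C (a t) * ∏ b ∈ univ.filter (fun b => key b = t), (M b).prod) →
      QPOrbitRestorable c' n p) :
    ∀ f : (n : ℕ) → MvPolynomial (Fin n × Fin n) ℂ, IsMatrixSymmetric f →
      (∃ c : ℕ, ∀ n : ℕ, PDClass (fun _ => 1) n c (f n)) →
      ∃ c : ℕ, ∀ n : ℕ, QPOrbitRestorable c n (f n) :=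
  WildResidueThms.sigmaPiSigmaValue_of_wildResidue_zero (wildResidue_of_sharp₄ (fun _ => 0) hW)

end WildResidueSharp

end Summit.ValiantsHypothesis.ValiantsHypothesis.Theorems.OrbitRestorationQPDepthThreeRung

end
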